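import Literature.MathematicalPhysics.QuantumFieldTheory.Balaban1983to89.B12GaugeInv47

/-!
# Bałaban CMP 109 (1987) §4 p. 284: «The group G is semisimple» — (4.13) ⇒ (4.14) ⇒ (4.15)₁ AT `B = 0` IN THE
CHART `V = exp iB` FOR `𝔤`-VALUED GAUGE FIELDS, i.e. BOTH named hypotheses `h414` ((4.14)) and `h415` ((4.15)₁) of
the lineage DISCHARGED from the concrete gauge action (4.7) and the semisimplicity of the Lie algebra

CITATION HEADER (lean-in-tree rule 2026-08-18).
* Source: T. Bałaban, "Renormalization group approach to lattice gauge field theories. I. Generation of effective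
  actions in a small field approximation and a coupling constant renormalization in four dimensions", Commun. Math.
  Phys. **109** (1987) 249–301, doi:10.1007/bf01215223 [Balaban1987RG1] (cell paper B12; held:
  `paper:balaban1987-cmp109-rg-i-small-field`; PDF page = journal page − 248), §4 pp. 282–284, displays
  (4.7)–(4.10), (4.13)–(4.15).  The sentences and displays of pp. 283–284 quoted below were READ AS IMAGES by the
  author of this file on the 300-dpi renders of the audit cell (`HOME/b2b-balaban-ref1/pages/1987-cmp109-rg-I-small-
  field/…-p035-x2.png` = p. 283, `…-p036-x2.png` = p. 284; HOME = the cell folder `run/shared/lean/pub/pub-balaban/`),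
  (4.7) of p. 282 is quoted as in the parent's header (`…B12GaugeInv47`, whose author read `…-p034-x2.png`), and all
  agree with the lineage transcript `HOME/b2b-balaban-b03/B12s-transcript.md`; inside quotation marks nothing is
  altered.  Audit cell `pub-balaban`, unit `b2b-balaban-b03-g21` (PAPER SUB-CELL B03 → B12 §§2–5 lineage, gen 21),
  node B12-SEMISIMPLE-414.  Imports only the lineage's own accepted module `…B12GaugeInv47` (gen 20: (4.7) ⇒ (4.9)
  `fderiv_apply_gaugeGenerator_eq_zero`, «For constant λ» `fderiv_one_apply_ad_eq_zero`, the generator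
  `exists_generatorCLM`; through it `…B12Ward59` (gen 19: (4.15)₁ + (5.1) + (5.2) ⇒ (5.9)
  `eq59_of_limit_of_gaugeInvariance`, and `moment2_eq_of_limit_of_gaugeInvariance`), `…B12Ward414` (gen 5:
  `ward_first_order`; its Lie section `adConst`, `span_range_eq_top_of_conj`,
  `span_range_adConst_eq_top_of_isSemisimple` = Cartan's criterion from Mathlib) and Mathlib's `NormedSpace.exp`,
  `LieAlgebra.IsSemisimple`); modifies nothing.
* Statements reproduced (verbatim).  p. 282 [PDF 34] (4.7): *"𝐄(V^v) = 𝐄(V), V^v(b) = v(b₋)V(b)v⁻¹(b₊)."*  p. 283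
  [PDF 35]: *"For a small gauge field V = exp iB, and a small gauge transformation v = exp iλ, B and λ small, we
  have"* (4.8) *"V^v(b) = exp iλ(b₋) exp iB(b) exp(−iλ(b₊)) = …, (1/i) log V^v(b) = … = B(b) + i[λ(b₋), B(b)] −
  g⁻¹(iad_{B(b)})(∂λ)(b) + …, where the dots denote terms of higher order in λ, and g⁻¹(z) = (−z)/(e^{−z} − 1) = 1 +
  ½z + k₂z² + …."*  *"Now differentiate the equality (4.7) with respect to λ, at λ = 0. This gives the identity"*
  (4.9) *"⟨(δ/δB)𝐄(exp iB), i[λ(b₋), B(b)] − g⁻¹(iad_{B(b)})(∂λ)(b)⟩ = 0 holding for all 𝔤^c-valued functions λ,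
  and small, 𝔤^c-valued configurations B. It is the fundamental identity expressing the gauge invariance of the
  function 𝐄."*  *"From this we derive a whole sequence of identities by differentiations with respect to B.
  For our purpose it is enough to consider expressions with four derivatives at most. Let us write the corresponding
  sequence of identities"* (4.10) *"⟨(δ²/δB²)𝐄(exp iB), iad_{λ₋}B − g⁻¹(iad_B)∂λ, B₁⟩ + ⟨(δ/δB)𝐄(exp iB), iad_{λ₋}B₁ −
  ½iad_{B₁}∂λ − k₂{iad_{B₁}, iad_B}∂λ − …⟩ = 0, where {A, B} = AB + BA"*.  p. 284 [PDF 36]: *"We are interested in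
  the above identities at B = 0, because such expressions only appear in the sum (4.6). This simplifies them in an
  essential way. Consider at first (4.10) at B = 0"* (4.13) *"⟨(δ²/δB²)𝐄(1), −∂λ, B₁⟩ + ⟨(δ/δB)𝐄(1), iad_{λ₋}B₁ −
  ½iad_{B₁}∂λ⟩ = 0.  For constant λ we get ⟨(δ/δB)𝐄(1), iad_λB₁⟩ = 0, and since the configuration B₁ is arbitrary,
  we get [λ, (δ/δB)𝐄(1)] = 0 for all λ ∈ 𝔤^c. The group G is semisimple, hence this is possible only for the element
  0 in the algebra 𝔤^c. Thus we have the first, very important consequence of the gauge invariance"* (4.14)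
  *"(δ/δB)𝐄(1) = 0.  This equality simplifies the identities, and also the sum (4.6), we can drop the term with
  n = 1. We obtain the following set of Ward-Takahashi identities"* (4.15)₁ *"⟨(δ²/δB²)𝐄(1), B₁, ∂λ⟩ = 0, …"* *"for
  an arbitrary gauge function λ, and arbitrary gauge fields B₁, B₂, B₃."*  And the bond convention, p. 284: *"The
  field B_μ(x) = B(x, x + e_μ) = …"*.
* Dictionary print → Lean (the only modelling choices; all bookkeeping, no analysis).  As in the parent
  `…B12GaugeInv47`: the bonds `b = (x, x + e_ν)` of a finite torus `T` (shifts `e : Λ → T`, directions `ν : Λ`), the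
  AMBIENT gauge field `W : Λ → T → 𝔄` with values in a complete normed real algebra `𝔄` (print: `M_N(ℂ) ⊃ G^c`), the
  functional `ℰ : (Λ → T → 𝔄) → F` (print's 𝐄), «analytic» weakened to `C²` at `W = 1`, the gauge action
  (4.7)/(4.8) `W ↦ (exp(tΛ(x)) W_ν(x) exp(−tΛ(x + e_ν)))_{ν,x}` (Mathlib's `NormedSpace.exp`) and
  `(∂λ)_ν(y) = λ(y + e_ν) − λ(y)`.  NEW HERE — print's actual setting «𝔤^c-valued functions λ, and small, 𝔤^c-valued
  configurations B»: the Lie algebra is a real normed space `V` (the charge space of `…B12Ward59`) represented in `𝔄`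
  by a continuous linear `ρ : V →L[ℝ] 𝔄` (print: the inclusion `𝔤^c ⊂ M_N(ℂ)`; the factor `i` of `exp iB`, `exp iλ`
  is absorbed into `ρ`, which changes nothing in identities at `B = 0`); the chart is `B ↦ (exp ρ(B_ν(x)))_{ν,x}` on
  `𝔤`-valued fields `B : Λ → T → V`, written out as a lambda in every statement; the gauge functions are `λ : T → V`,
  acting through `Λ = ρ ∘ λ`.  «The group G is semisimple» enters through two properties of `ρ`: CLOSURE
  `hcl : ∀ a b, ∃ c, ρc = ρa·ρb − ρb·ρa` and PERFECTNESS `hspan : span {c | ρc = [ρl, ρv] for some l, v} = V`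
  (`[𝔤, 𝔤] = 𝔤` read through `ρ`), and both are DERIVED (§5) from Mathlib's `LieAlgebra.IsSemisimple ℝ 𝔤` for any
  linear identification `eV : V ≃ₗ[ℝ] 𝔤` under which `ρ` intertwines the bracket with the commutator (`hρ` — i.e.
  `ρ ∘ eV⁻¹` is a representation of `𝔤` in `𝔄`); the abstract `𝔤` is kept apart from the normed `V` only so as not
  to mix Mathlib's normed and Lie instance hierarchies on one carrier.  The module is DEFINITION-FREE.
  AMBIENT-TYPING CAVEAT: `ℰ` is asked to be `C²` at `1` and gauge invariant near `1` as a function of the AMBIENT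
  `𝔄`-valued field, whereas print's 𝐄 is a function of `G^c`-valued fields; since every conclusion concerns only
  the chart functional `B ↦ ℰ(exp ρB)` of `𝔤`-valued fields, this is a strengthening of the HYPOTHESIS (an invariant
  analytic 𝐄 on `G^c`-fields near `1` has such extensions, e.g. for `G^c = SL(N, ℂ)` `W ↦ 𝐄((det W)^{−1/N}W)`),
  whose construction is NOT formalised here.
* The mathematics (print's p. 284 argument; the one calculus step print leaves implicit made explicit).  For
  `f(B) = ℰ(exp ρB)`: `Df(0)u = Dℰ(1)[ρu]` and `D²f(0)(u, w) = D²ℰ(1)(ρu, ρw) + Dℰ(1)[½(ρu·ρw + ρw·ρu)]` (second-order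
  chain rule with `d² exp(0)(a, b) = ½(ab + ba)` — print's `{A, B} = AB + BA` of (4.10)); (4.7) ⇒ (4.9)
  `Dℰ(W)[Λ₋W − WΛ₊] = 0` near `W = 1` ⇒ (its `W`-derivative at `1`) `D²ℰ(1)(U, ∂Λ) = Dℰ(1)[Λ₋U − UΛ₊]` — (4.10) at
  `B = 0`, i.e. (4.13), in `V`-coordinates; and `Λ₋U − UΛ₊ + ½(U·∂Λ + ∂Λ·U) = ½[Λ₋, U] + ½[Λ₊, U]`, so
  `D²f(0)(u, ∂λ) = Dℰ(1)[ρ(½[λ₋, u] + ½[λ₊, u])]` is `Dℰ(1)` of a `𝔤`-VALUED field (closure); (4.13) for constant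
  `λ` («⟨(δ/δB)𝐄(1), iad_λB₁⟩ = 0») + «B₁ is arbitrary» + perfectness ⇒ `Dℰ(1)` vanishes on every `𝔤`-valued field,
  (4.14) in the chart `Df(0) = 0`; hence (4.15)₁ `D²f(0)(u, ∂λ) = 0`.

WHAT IS PROVED (kernel-checked, no `sorry`, standard axioms, NO definitions; bookkeeping theorems, every analytic
input a NAMED HYPOTHESIS):
* §1 calculus of Mathlib's `exp` at `0` in a complete normed algebra — `contDiff_exp`, `fderiv_exp_smul_apply_self`,
  `fderiv_fderiv_exp_zero_apply_self` (`d² exp(0)(a, a) = a²`), `fderiv_fderiv_exp_zero_apply` (`d² exp(0)(a, b) =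
  ½(ab + ba)`, by polarization and the symmetry of second derivatives); the chart — `chart_zero`, `contDiff_chart`,
  `contDiff_comp_chart`, `hasFDerivAt_chart_zero`, `fderiv_chart_zero_apply` (`D(exp ρ·)(0)u = ρu`),
  `fderiv_fderiv_chart_zero_apply`, the chain rules `fderiv_comp_chart_zero_apply`,
  `fderiv_fderiv_comp_chart_zero_apply`; the pointwise identity `ward_plus_jordan_eq_half_commutators`.
* §2 `hessian_one_apply_grad_eq` — **(4.7) ⇒ (4.10) at `B = 0` ((4.13)) in `V`-coordinates, WITHOUT (4.14)**:
  `D²ℰ(1)(U, ∂Λ) = Dℰ(1)[Λ₋U − UΛ₊]`; `hessian_chart_apply_grad_eq` — **(4.13) in the chart**: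
  `D²f(0)(u, ∂λ) = Dℰ(1)[ρ(½[λ₋, u] + ½[λ₊, u])]`.
* §3 `fderiv_chart_zero_eq_zero` — **«For constant λ … The group G is semisimple, hence» (4.14) IN THE CHART**: (4.7)
  for the constant `λ ∈ 𝔤` + perfectness ⇒ `D[B ↦ ℰ(exp ρB)](0) = 0`; `fderiv_one_apply_rho_eq_zero` — `Dℰ(1)[ρw] =
  0` for every `𝔤`-valued field `w`.
* §4 `hessian_chart_apply_grad_eq_zero` — **(4.7) + closure + perfectness ⇒ (4.15)₁ at `B = 0` in the chart**:
  `D²[B ↦ ℰ(exp ρB)](0)(B₁, ∂λ) = 0` for all `𝔤`-valued `B₁`, `λ` — the hypothesis `h415` of `…B12Ward59` /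
  `…B12Rep538Limit` for the chart functional, with NO residual hypothesis (4.14) (contrast the parent's
  `h415_of_gaugeInvariance`, which needs `h414 : Dℰ(1) = 0` on ALL ambient directions — false in general for
  `𝔄 = M_N`, the trace direction).
* §5 `exists_rho_eq_commutator`, `span_commutatorSet_eq_top_of_isSemisimple` — closure and perfectness from
  `LieAlgebra.IsSemisimple ℝ 𝔤` (by name from `…B12Ward414.span_range_adConst_eq_top_of_isSemisimple`, Mathlib's
  Cartan criterion, on one bond, transported along `eV` by `…B12Ward414.span_range_eq_top_of_conj`).
* §6 `eq59_of_limit_of_gaugeInvariance_lie`, `eq59_of_limit_of_gaugeInvariance_of_isSemisimple` — **(4.7) + «G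
  semisimple» + (5.1) + (5.2) ⇒ (5.9)₁,₂, `WardB`, `WardB₂` for the limit tensor** (the parent's
  `eq59_of_limit_of_gaugeInvariance47` with `h414` REMOVED);
  `moment2_eq_of_limit_of_gaugeInvariance_of_isSemisimple` — **+ (5.3) + (5.10) ⇒ (4.43), (4.45), `Σ_y Π = 0`**
  (`…B12Ward59.moment2_eq_of_limit_of_gaugeInvariance` with `h415` discharged).

WHAT IS NOT PROVED HERE (and not claimed): the identities (4.10)–(4.12) away from `B = 0` and (4.15)₂,₃ (they need
the `B`-dependent generator `i[λ₋, B] − g⁻¹(iad_B)∂λ`, `d log` away from `0`; abstract machinery: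
`…B12Ward414.ward_second_order`, `ward_third_order`); the existence, analyticity and gauge / Euclidean invariance of
print's effective actions `𝐄^{(j)}` (B12 §§2–3, the renormalization group construction), the limit (5.1) and the
decay (5.10) — the named hypotheses of §6; print's remark (p. 283) that `G^c`-invariance follows from
`G`-invariance and analyticity (invariance is assumed here directly, over `ℝ`, for the flows used); the ambient
extension of the caveat above; nothing about B13 or the continuum limit.

HONEST FRAMING: value = the two structural hypotheses `h414` ((4.14)) and `h415` ((4.15)₁) under which gens 17–20
derived (5.9), (4.43), (4.45) for the limit tensor are now kernel-checked CONSEQUENCES of exactly the two inputs print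
names on p. 284 — the gauge invariance (4.7) and «The group G is semisimple» — in print's own setting of `𝔤`-valued
`B` and `λ`, with the second-order chart calculus print leaves implicit done over Mathlib's exponential and the
semisimplicity step over Mathlib's Lie theory; one more printed implication of B12 §4 made by-name composable.  NOT
summit progress: bookkeeping of printed displays; every analytic statement remains a hypothesis.
-/

namespace Literature.MathematicalPhysics.QuantumFieldTheory.Balaban1983to89.B12Semisimple414

open Literature.MathematicalPhysics.QuantumFieldTheory.GawedzkiKupiainen1985.PeriodicGleason (Pt unitVec)
open Literature.MathematicalPhysics.QuantumFieldTheory.Balaban1983to89.B12Sec2to5 (Decay510)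
open Literature.MathematicalPhysics.QuantumFieldTheory.Balaban1983to89.B12Transverse536 (WardFirst WardB rsgn)
open Literature.MathematicalPhysics.QuantumFieldTheory.Balaban1983to89.B12Marginal444 (kdA)
open Literature.MathematicalPhysics.QuantumFieldTheory.Balaban1983to89.B12Covariance54 (permPt twist)
open Literature.MathematicalPhysics.QuantumFieldTheory.Balaban1983to89.B12WardLeadingForm (WardB₂)
open Literature.MathematicalPhysics.QuantumFieldTheory.Balaban1983to89.B12Form543 (ofRealK)
open Literature.MathematicalPhysics.QuantumFieldTheory.Balaban1983to89.B12Ward414 (ward_first_order adConst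
  adConst_apply span_range_adConst_eq_top_of_isSemisimple span_range_eq_top_of_conj)
open Literature.MathematicalPhysics.QuantumFieldTheory.Balaban1983to89.B12Ward59 (eq59_of_limit_of_gaugeInvariance
  moment2_eq_of_limit_of_gaugeInvariance)
open Literature.MathematicalPhysics.QuantumFieldTheory.Balaban1983to89.B12GaugeInv47 (exists_generatorCLM
  fderiv_apply_gaugeGenerator_eq_zero fderiv_one_apply_ad_eq_zero)
open NormedSpace (exp exp_zero exp_analytic)
open Filter
open _root_.Topology

/-! ## §1. Calculus of the exponential chart: `d exp|₀ = id`, `d² exp|₀(a, b) = ½(ab + ba)`, and the second-order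
chain rule for `B ↦ 𝐄(exp iB)` at `B = 0` WITHOUT (4.14) -/

section ExpCalculus

variable {𝔄 : Type*} [NormedRing 𝔄] [NormedAlgebra ℝ 𝔄] [CompleteSpace 𝔄]

/-- Mathlib's exponential of a complete normed real algebra is smooth. [folklore] -/
theorem contDiff_exp {n : WithTop ℕ∞} : ContDiff ℝ n (exp : 𝔄 → 𝔄) :=
  contDiff_iff_contDiffAt.2 fun a => (exp_analytic (𝕂 := ℝ) a).contDiffAt

/-- `d exp(ta)[a] = a·exp(ta)`: the derivative of `exp` at a point of the ray through `a`, in the direction `a`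
(the chain rule against `d/dt exp(ta) = a exp(ta)`, Mathlib `hasDerivAt_exp_smul_const'`). [folklore] -/
theorem fderiv_exp_smul_apply_self (a : 𝔄) (t : ℝ) : fderiv ℝ exp (t • a) a = a * exp (t • a) := by
  have h1 : HasDerivAt (fun u : ℝ => exp (u • a)) (a * exp (t • a)) t := hasDerivAt_exp_smul_const' (𝕂 := ℝ) a t
  have he : HasFDerivAt (exp : 𝔄 → 𝔄) (fderiv ℝ exp (t • a)) (t • a) :=
    ((contDiff_exp (𝔄 := 𝔄) (n := 1)).differentiable (by simp) (t • a)).hasFDerivAt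
  have hl : HasDerivAt (fun u : ℝ => u • a) a t := by
    simpa using (hasDerivAt_id t).smul_const a
  have h2 : HasDerivAt (fun u : ℝ => exp (u • a)) (fderiv ℝ exp (t • a) a) t :=
    he.comp_hasDerivAt_of_eq t hl rfl
  exact h2.unique h1

/-- **`d² exp|₀(a, a) = a²`** (the second `t`-derivative of `exp(ta)` at `t = 0`; print's «exp iB = 1 + iB + …» to
second order on the diagonal). [folklore] -/
theorem fderiv_fderiv_exp_zero_apply_self (a : 𝔄) : fderiv ℝ (fderiv ℝ (exp : 𝔄 → 𝔄)) 0 a a = a * a := by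
  -- the curve `t ↦ d exp(ta)` in `𝔄 →L[ℝ] 𝔄` has derivative `d² exp(0)[a]` at `t = 0`
  have hcurve : HasDerivAt (fun t : ℝ => fderiv ℝ (exp : 𝔄 → 𝔄) (t • a))
      (fderiv ℝ (fderiv ℝ (exp : 𝔄 → 𝔄)) 0 a) 0 := by
    have hD : HasFDerivAt (fderiv ℝ (exp : 𝔄 → 𝔄)) (fderiv ℝ (fderiv ℝ (exp : 𝔄 → 𝔄)) 0) ((0 : ℝ) • a) := by
      rw [zero_smul]
      exact (((contDiff_exp (𝔄 := 𝔄) (n := 2)).contDiffAt.fderiv_right (m := 1) le_rfl).differentiableAt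
        (by simp)).hasFDerivAt
    have hl : HasDerivAt (fun u : ℝ => u • a) a 0 := by
      simpa using (hasDerivAt_id (0 : ℝ)).smul_const a
    exact hD.comp_hasDerivAt_of_eq 0 hl rfl
  -- hence `t ↦ d exp(ta)[a]` has derivative `d² exp(0)(a, a)` at `0` …
  have happly : HasDerivAt (fun t : ℝ => fderiv ℝ (exp : 𝔄 → 𝔄) (t • a) a)
      (fderiv ℝ (fderiv ℝ (exp : 𝔄 → 𝔄)) 0 a a) 0 := by
    have h := hcurve.clm_apply (hasDerivAt_const (0 : ℝ) a)
    simpa using h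
  -- … while `d exp(ta)[a] = a exp(ta)` has derivative `a·a` at `0`
  have hformula : HasDerivAt (fun t : ℝ => fderiv ℝ (exp : 𝔄 → 𝔄) (t • a) a) (a * a) 0 := by
    have h : HasDerivAt (fun t : ℝ => a * exp (t • a)) (a * (a * exp ((0 : ℝ) • a))) 0 :=
      (hasDerivAt_exp_smul_const' (𝕂 := ℝ) a 0).const_mul a
    simp only [zero_smul, exp_zero, mul_one] at h
    exact h.congr_of_eventuallyEq (Eventually.of_forall fun t => fderiv_exp_smul_apply_self a t)
  exact happly.unique hformula

/-- **`d² exp|₀(a, b) = ½(ab + ba)`** — by polarization of `fderiv_fderiv_exp_zero_apply_self` and the symmetry of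
second derivatives (the Jordan product: print's «exp iB = 1 + iB + …» to second order). [folklore] -/
theorem fderiv_fderiv_exp_zero_apply (a b : 𝔄) :
    fderiv ℝ (fderiv ℝ (exp : 𝔄 → 𝔄)) 0 a b = (2 : ℝ)⁻¹ • (a * b + b * a) := by
  have hsymm : fderiv ℝ (fderiv ℝ (exp : 𝔄 → 𝔄)) 0 b a = fderiv ℝ (fderiv ℝ (exp : 𝔄 → 𝔄)) 0 a b :=
    ((contDiff_exp (𝔄 := 𝔄) (n := 2)).contDiffAt.isSymmSndFDerivAt (by simp)) b a
  have hab := fderiv_fderiv_exp_zero_apply_self (a + b)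
  simp only [map_add, add_apply, fderiv_fderiv_exp_zero_apply_self, hsymm, mul_add, add_mul] at hab
  rw [eq_inv_smul_iff₀ (two_ne_zero (α := ℝ)), two_smul]
  calc fderiv ℝ (fderiv ℝ (exp : 𝔄 → 𝔄)) 0 a b + fderiv ℝ (fderiv ℝ (exp : 𝔄 → 𝔄)) 0 a b
      = (a * a + fderiv ℝ (fderiv ℝ (exp : 𝔄 → 𝔄)) 0 a b + (fderiv ℝ (fderiv ℝ (exp : 𝔄 → 𝔄)) 0 a b + b * b))
          - a * a - b * b := by abel
    _ = (a * a + b * a + (a * b + b * b)) - a * a - b * b := by rw [hab]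
    _ = a * b + b * a := by abel

omit [CompleteSpace 𝔄] in
/-- The pointwise algebra behind (4.13): `λ₋U − Uλ₊ + ½(U·∂λ + ∂λ·U) = ½([λ₋, U] + [λ₊, U])`, `∂λ = λ₊ − λ₋` —
the Jordan term of the chart plus the generator term of (4.9) is a sum of COMMUTATORS (print: «iad_{λ₋}B₁ −
½iad_{B₁}∂λ»). [folklore] -/
theorem ward_plus_jordan_eq_half_commutators (Lm Lp U : 𝔄) :
    Lm * U - U * Lp + (2 : ℝ)⁻¹ • (U * (Lp - Lm) + (Lp - Lm) * U) =
      (2 : ℝ)⁻¹ • ((Lm * U - U * Lm) + (Lp * U - U * Lp)) := by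
  have key : (2 : ℝ) • (Lm * U - U * Lp) + (U * (Lp - Lm) + (Lp - Lm) * U) =
      (Lm * U - U * Lm) + (Lp * U - U * Lp) := by
    rw [two_smul]
    noncomm_ring
  rw [← key, smul_add (2 : ℝ)⁻¹ ((2 : ℝ) • (Lm * U - U * Lp)), inv_smul_smul₀ (two_ne_zero (α := ℝ))]

variable {Λ T : Type*} [Fintype Λ] [Fintype T] {V : Type*} [NormedAddCommGroup V] [NormedSpace ℝ V]
  {F : Type*} [NormedAddCommGroup F] [NormedSpace ℝ F]

omit [CompleteSpace 𝔄] [Fintype Λ] [Fintype T] in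
/-- `exp i0 = 1`: the chart `B ↦ (exp ρ(B_ν(x)))_{ν,x}` of `𝔤`-valued fields (`ρ : 𝔤 → 𝔄` the representation,
print's `𝔤^c ⊂ M_N(ℂ)`; the factor `i` absorbed) at `B = 0`. [folklore] -/
theorem chart_zero (ρ : V →L[ℝ] 𝔄) : (fun ν x => exp (ρ ((0 : Λ → T → V) ν x))) = (1 : Λ → T → 𝔄) := by
  funext ν x
  simp [exp_zero]

/-- The chart `B ↦ (exp ρ(B_ν(x)))_{ν,x}` is smooth. [folklore] -/
theorem contDiff_chart (ρ : V →L[ℝ] 𝔄) {n : WithTop ℕ∞} :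
    ContDiff ℝ n (fun B : Λ → T → V => fun ν x => exp (ρ (B ν x))) := by
  refine contDiff_pi.2 fun ν => contDiff_pi.2 fun x => ?_
  have h := (contDiff_exp (𝔄 := 𝔄) (n := n)).comp (ρ.contDiff.comp (contDiff_apply_apply ℝ V ν x))
  simpa only [Function.comp_def] using h

/-- `B ↦ 𝐄(exp iρB)` is `Cⁿ` if `𝐄` is. [folklore] -/
theorem contDiff_comp_chart {ℰ : (Λ → T → 𝔄) → F} (ρ : V →L[ℝ] 𝔄) {n : WithTop ℕ∞} (hℰ : ContDiff ℝ n ℰ) :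
    ContDiff ℝ n (fun B : Λ → T → V => ℰ (fun ν x => exp (ρ (B ν x)))) :=
  hℰ.comp (contDiff_chart ρ)

/-- **`d(exp iρB)|_{B=0} = ρ`** sitewise (the first line of (4.8) to first order). [folklore] -/
theorem hasFDerivAt_chart_zero (ρ : V →L[ℝ] 𝔄) :
    HasFDerivAt (fun B : Λ → T → V => fun ν x => exp (ρ (B ν x)))
      (ContinuousLinearMap.pi fun ν => ContinuousLinearMap.pi fun x =>
        ρ.comp ((ContinuousLinearMap.proj (R := ℝ) (φ := fun _ : T => V) x).comp
          (ContinuousLinearMap.proj (R := ℝ) (φ := fun _ : Λ => T → V) ν))) 0 := by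
  refine hasFDerivAt_pi'.2 fun ν => hasFDerivAt_pi'.2 fun x => ?_
  have he : HasFDerivAt (fun B : Λ → T → V => ρ (B ν x))
      (ρ.comp ((ContinuousLinearMap.proj (R := ℝ) (φ := fun _ : T => V) x).comp
        (ContinuousLinearMap.proj (R := ℝ) (φ := fun _ : Λ => T → V) ν))) 0 :=
    (ρ.comp ((ContinuousLinearMap.proj (R := ℝ) (φ := fun _ : T => V) x).comp
      (ContinuousLinearMap.proj (R := ℝ) (φ := fun _ : Λ => T → V) ν))).hasFDerivAt
  have hexp : HasFDerivAt (exp : 𝔄 → 𝔄) (1 : 𝔄 →L[ℝ] 𝔄) ((fun B : Λ → T → V => ρ (B ν x)) 0) := by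
    have h0 : (fun B : Λ → T → V => ρ (B ν x)) 0 = 0 := by simp
    rw [h0]
    exact hasFDerivAt_exp_zero (𝕂 := ℝ)
  have h := hexp.comp (0 : Λ → T → V) he
  refine (h.congr_fderiv ?_ : HasFDerivAt (fun B : Λ → T → V => exp (ρ (B ν x))) _ 0)
  ext B
  simp

/-- `d(𝐄∘chart)`-bookkeeping: `d(exp iρB)|_{B=0}[u] = (ρ(u_ν(x)))_{ν,x}`. [folklore] -/
theorem fderiv_chart_zero_apply (ρ : V →L[ℝ] 𝔄) (u : Λ → T → V) :
    fderiv ℝ (fun B : Λ → T → V => fun ν x => exp (ρ (B ν x))) 0 u = fun ν x => ρ (u ν x) := by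
  rw [(hasFDerivAt_chart_zero ρ).fderiv]
  rfl

/-- **`d²(exp iρB)|_{B=0}(u, w) = (½(ρu_ν(x)·ρw_ν(x) + ρw_ν(x)·ρu_ν(x)))_{ν,x}`** — the second derivative of the
chart is SITEWISE the Jordan product (`fderiv_fderiv_exp_zero_apply` at every bond, through the evaluation maps).
[folklore] -/
theorem fderiv_fderiv_chart_zero_apply (ρ : V →L[ℝ] 𝔄) (u w : Λ → T → V) :
    fderiv ℝ (fderiv ℝ (fun B : Λ → T → V => fun ν x => exp (ρ (B ν x)))) 0 u w =
      fun ν x => (2 : ℝ)⁻¹ • (ρ (u ν x) * ρ (w ν x) + ρ (w ν x) * ρ (u ν x)) := by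
  funext ν x
  set Φ : (Λ → T → V) → Λ → T → 𝔄 := fun B ν x => exp (ρ (B ν x)) with hΦ
  have hC : ContDiff ℝ 2 Φ := contDiff_chart ρ
  -- the evaluation at the bond `(ν, x)` and the linear map `B ↦ ρ(B_ν(x))`
  set ev : (Λ → T → 𝔄) →L[ℝ] 𝔄 := (ContinuousLinearMap.proj (R := ℝ) (φ := fun _ : T => 𝔄) x).comp
    (ContinuousLinearMap.proj (R := ℝ) (φ := fun _ : Λ => T → 𝔄) ν) with hev
  set L : (Λ → T → V) →L[ℝ] 𝔄 := ρ.comp ((ContinuousLinearMap.proj (R := ℝ) (φ := fun _ : T => V) x).comp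
    (ContinuousLinearMap.proj (R := ℝ) (φ := fun _ : Λ => T → V) ν)) with hL
  have h1 : (ev : (Λ → T → 𝔄) → 𝔄) ∘ Φ = (exp : 𝔄 → 𝔄) ∘ (L : (Λ → T → V) → 𝔄) := by
    funext B
    simp [hΦ, hev, hL]
  calc fderiv ℝ (fderiv ℝ Φ) 0 u w ν x
      = ev (iteratedFDeriv ℝ 2 Φ 0 ![u, w]) := by
          rw [iteratedFDeriv_two_apply]
          simp [hev]
    _ = iteratedFDeriv ℝ 2 ((ev : (Λ → T → 𝔄) → 𝔄) ∘ Φ) 0 ![u, w] := by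
          rw [ev.iteratedFDeriv_comp_left hC.contDiffAt (i := 2) le_rfl]
          rfl
    _ = iteratedFDeriv ℝ 2 ((exp : 𝔄 → 𝔄) ∘ (L : (Λ → T → V) → 𝔄)) 0 ![u, w] := by rw [h1]
    _ = iteratedFDeriv ℝ 2 (exp : 𝔄 → 𝔄) (L 0) (fun i => L (![u, w] i)) := by
          rw [L.iteratedFDeriv_comp_right (contDiff_exp (n := 2)) 0 (i := 2) le_rfl]
          rfl
    _ = fderiv ℝ (fderiv ℝ (exp : 𝔄 → 𝔄)) 0 (ρ (u ν x)) (ρ (w ν x)) := by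
          rw [iteratedFDeriv_two_apply]
          simp [hL]
    _ = (2 : ℝ)⁻¹ • (ρ (u ν x) * ρ (w ν x) + ρ (w ν x) * ρ (u ν x)) := fderiv_fderiv_exp_zero_apply _ _

/-- **First-order chain rule at `B = 0`**: `d[𝐄(exp iρB)]|₀[u] = d𝐄(1)[(ρu_ν(x))_{ν,x}]`. [folklore] -/
theorem fderiv_comp_chart_zero_apply {ℰ : (Λ → T → 𝔄) → F} (ρ : V →L[ℝ] 𝔄) (hℰ : DifferentiableAt ℝ ℰ 1)
    (u : Λ → T → V) :
    fderiv ℝ (fun B : Λ → T → V => ℰ (fun ν x => exp (ρ (B ν x)))) 0 u = fderiv ℝ ℰ 1 (fun ν x => ρ (u ν x)) := by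
  have hΦ := hasFDerivAt_chart_zero (Λ := Λ) (T := T) ρ
  have h1 : HasFDerivAt ℰ (fderiv ℝ ℰ 1) ((fun B : Λ → T → V => fun ν x => exp (ρ (B ν x))) 0) := by
    beta_reduce
    rw [chart_zero]
    exact hℰ.hasFDerivAt
  have h : HasFDerivAt (fun B : Λ → T → V => ℰ (fun ν x => exp (ρ (B ν x))))
      ((fderiv ℝ ℰ 1).comp (ContinuousLinearMap.pi fun ν => ContinuousLinearMap.pi fun x =>
        ρ.comp ((ContinuousLinearMap.proj (R := ℝ) (φ := fun _ : T => V) x).comp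
          (ContinuousLinearMap.proj (R := ℝ) (φ := fun _ : Λ => T → V) ν)))) 0 :=
    h1.comp (0 : Λ → T → V) hΦ
  rw [h.fderiv]
  rfl

/-- **Second-order chain rule at `B = 0` WITHOUT (4.14)**:
`d²[𝐄(exp iρB)]|₀(u, w) = d²𝐄(1)(ρu, ρw) + d𝐄(1)[½(ρu·ρw + ρw·ρu)]` — the Hessian of the chart functional is the
Hessian of `𝐄` on the images PLUS the gradient of `𝐄` on the Jordan term (which (4.14) would kill for `𝔄`-valued
fields, `…B12GaugeInv47.hessian_comp_expChart_zero`; here it is KEPT, since for `𝔤`-valued fields only the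
`𝔤`-directions of `d𝐄(1)` vanish). [folklore] -/
theorem fderiv_fderiv_comp_chart_zero_apply {ℰ : (Λ → T → 𝔄) → F} (ρ : V →L[ℝ] 𝔄) (hℰ : ContDiffAt ℝ 2 ℰ 1)
    (u w : Λ → T → V) :
    fderiv ℝ (fderiv ℝ (fun B : Λ → T → V => ℰ (fun ν x => exp (ρ (B ν x))))) 0 u w =
      fderiv ℝ (fderiv ℝ ℰ) 1 (fun ν x => ρ (u ν x)) (fun ν x => ρ (w ν x)) +
        fderiv ℝ ℰ 1 (fun ν x => (2 : ℝ)⁻¹ • (ρ (u ν x) * ρ (w ν x) + ρ (w ν x) * ρ (u ν x))) := by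
  set Φ : (Λ → T → V) → Λ → T → 𝔄 := fun B ν x => exp (ρ (B ν x)) with hΦ
  show fderiv ℝ (fderiv ℝ (fun B : Λ → T → V => ℰ (Φ B))) 0 u w = _
  have hC : ContDiff ℝ 2 Φ := contDiff_chart ρ
  have hΦ0 : Φ 0 = 1 := chart_zero ρ
  have hΦ1 : ∀ u : Λ → T → V, fderiv ℝ Φ 0 u = fun ν x => ρ (u ν x) := fderiv_chart_zero_apply ρ
  have hΦ2 : ∀ u w : Λ → T → V, fderiv ℝ (fderiv ℝ Φ) 0 u w =
      fun ν x => (2 : ℝ)⁻¹ • (ρ (u ν x) * ρ (w ν x) + ρ (w ν x) * ρ (u ν x)) :=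
    fderiv_fderiv_chart_zero_apply ρ
  have hcont : Tendsto Φ (𝓝 0) (𝓝 1) := by
    have h := hC.continuous.tendsto (0 : Λ → T → V)
    rwa [hΦ0] at h
  have hdiff : ∀ᶠ W in 𝓝 (1 : Λ → T → 𝔄), DifferentiableAt ℝ ℰ W := by
    filter_upwards [hℰ.eventually (by simp)] with W hW
    exact hW.differentiableAt (by simp)
  have hdE : ∀ B : Λ → T → V, DifferentiableAt ℝ Φ B := fun B => hC.differentiable (by simp) B
  have hchain : ∀ᶠ B in 𝓝 (0 : Λ → T → V),
      fderiv ℝ (fun B => ℰ (Φ B)) B = (fderiv ℝ ℰ (Φ B)).comp (fderiv ℝ Φ B) := by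
    filter_upwards [hcont.eventually hdiff] with B hB
    exact fderiv_fun_comp (x := B) hB (hdE B)
  have hEq : fderiv ℝ (fderiv ℝ (fun B => ℰ (Φ B))) 0 =
      fderiv ℝ (fun B => (fderiv ℝ ℰ (Φ B)).comp (fderiv ℝ Φ B)) 0 :=
    Filter.EventuallyEq.fderiv_eq hchain
  have hc : HasFDerivAt (fun B : Λ → T → V => fderiv ℝ ℰ (Φ B))
      ((fderiv ℝ (fderiv ℝ ℰ) 1).comp (fderiv ℝ Φ 0)) 0 := by
    have h1 : HasFDerivAt (fderiv ℝ ℰ) (fderiv ℝ (fderiv ℝ ℰ) 1) (Φ 0) := by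
      rw [hΦ0]
      exact ((hℰ.fderiv_right (m := 1) le_rfl).differentiableAt (by simp)).hasFDerivAt
    -- (fully explicit form, as in `…B12GaugeInv47.hessian_comp_expChart_zero`: with the codomain left implicit the
    -- elaborator does not unify the product topological-module structure of `Λ → T → 𝔄` with the one underlying
    -- its normed structure)
    exact @HasFDerivAt.comp ℝ _ (Λ → T → V) _ _ (Λ → T → 𝔄) _ _ ((Λ → T → 𝔄) →L[ℝ] F) _ _ Φ
      (fderiv ℝ Φ 0) (0 : Λ → T → V) (fderiv ℝ ℰ) (fderiv ℝ (fderiv ℝ ℰ) 1) h1 (hdE 0).hasFDerivAt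
  have hd : HasFDerivAt (fun B : Λ → T → V => fderiv ℝ Φ B) (fderiv ℝ (fderiv ℝ Φ) 0) 0 :=
    ((hC.contDiffAt.fderiv_right (m := 1) le_rfl).differentiableAt (by simp)).hasFDerivAt
  rw [hEq, (hc.clm_comp hd).fderiv]
  simp only [add_apply, ContinuousLinearMap.coe_comp, Function.comp_apply, ContinuousLinearMap.compL_apply,
    ContinuousLinearMap.flip_apply, hΦ0, hΦ1, hΦ2]
  rw [add_comm]

end ExpCalculus

/-! ## §2. (4.13) at `B = 0` in the chart, for a `𝔤`-valued gauge function: (4.7) ⇒ (4.9) ⇒ (4.10)|₀ -/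

section WardChart

variable {𝔄 : Type*} [NormedRing 𝔄] [NormedAlgebra ℝ 𝔄] [CompleteSpace 𝔄] {Λ T : Type*} [Fintype Λ] [Fintype T]
  [AddCommGroup T] {V : Type*} [NormedAddCommGroup V] [NormedSpace ℝ V] {F : Type*} [NormedAddCommGroup F]
  [NormedSpace ℝ F]

/-- **(4.10) at `B = 0` in `V`-coordinates, WITHOUT (4.14)** (p. 283 «From this we derive a whole sequence of
identities by differentiations with respect to B.» (4.10) «⟨(δ²/δB²)𝐄(exp iB), iad_{λ₋}B − g⁻¹(iad_B)∂λ, B₁⟩ +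
⟨(δ/δB)𝐄(exp iB), iad_{λ₋}B₁ − ½iad_{B₁}∂λ − k₂{iad_{B₁}, iad_B}∂λ − …⟩ = 0», p. 284 «Consider at first (4.10) at
B = 0» (4.13)): if `𝐄` is `C²` at `V = 1` and invariant under the gauge flow of `Λ` ((4.7)) near `V = 1` for small
`t`, then `D²𝐄(1)(U, ∂Λ) = D𝐄(1)[Λ(b₋)U(b) − U(b)Λ(b₊)]` for every direction `U` — the
`W`-derivative at `1` of the identically vanishing (4.9) `W ↦ D𝐄(W)[Λ₋W − WΛ₊]` (`…B12Ward414.ward_first_order` with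
the affine generator field `U ↦ L_Λ(1 + U)`, value `−∂Λ` at `U = 0`). [cite: Balaban1987RG1, (4.7) p.282,
(4.9)-(4.10) p.283, (4.13) p.284] -/
theorem hessian_one_apply_grad_eq {ℰ : (Λ → T → 𝔄) → F} (e : Λ → T) (hℰ : ContDiffAt ℝ 2 ℰ 1) (Lam : T → 𝔄)
    (h47 : ∀ᶠ W in 𝓝 (1 : Λ → T → 𝔄), ∀ᶠ t in 𝓝 (0 : ℝ),
      ℰ (fun ν x => exp (t • Lam x) * W ν x * exp (-(t • Lam (x + e ν)))) = ℰ W) (U : Λ → T → 𝔄) :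
    fderiv ℝ (fderiv ℝ ℰ) 1 U (fun ν y => Lam (y + e ν) - Lam y) =
      fderiv ℝ ℰ 1 (fun ν x => Lam x * U ν x - U ν x * Lam (x + e ν)) := by
  obtain ⟨L, hL⟩ := exists_generatorCLM e Lam
  set ℰ₁ : (Λ → T → 𝔄) → F := fun U => ℰ (1 + U) with hℰ₁
  have hD : ∀ U, fderiv ℝ ℰ₁ U = fderiv ℝ ℰ (1 + U) := fun U => fderiv_comp_add_left 1
  have hD' : fderiv ℝ ℰ₁ = fun U => fderiv ℝ ℰ (1 + U) := funext hD
  have hDD : fderiv ℝ (fderiv ℝ ℰ₁) 0 = fderiv ℝ (fderiv ℝ ℰ) 1 := by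
    rw [hD']
    have h := fderiv_comp_add_left (𝕜 := ℝ) (f := fderiv ℝ ℰ) (x := (0 : Λ → T → 𝔄)) (1 : Λ → T → 𝔄)
    rwa [add_zero] at h
  have h1C : ContDiffAt ℝ 2 ℰ₁ 0 := by
    have h : ContDiffAt ℝ 2 ℰ ((fun U : Λ → T → 𝔄 => 1 + U) 0) := by simpa using hℰ
    exact h.comp 0 (contDiffAt_const.add contDiffAt_id)
  have hdiff : ∀ᶠ W in 𝓝 (1 : Λ → T → 𝔄), DifferentiableAt ℝ ℰ W := by
    filter_upwards [hℰ.eventually (by simp)] with W hW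
    exact hW.differentiableAt (by simp)
  have hc : Tendsto (fun U : Λ → T → 𝔄 => 1 + U) (𝓝 0) (𝓝 1) := by
    have hcts : Continuous (fun U : Λ → T → 𝔄 => 1 + U) := by fun_prop
    simpa using hcts.tendsto 0
  have hX : DifferentiableAt ℝ (fun U : Λ → T → 𝔄 => L (1 + U)) 0 :=
    L.differentiableAt.comp 0 ((differentiableAt_const _).add differentiableAt_id)
  have hXD : fderiv ℝ (fun U : Λ → T → 𝔄 => L (1 + U)) 0 = L := by
    rw [fderiv_comp_add_left, L.fderiv]
  have hL1 : L 1 = -(fun ν y => Lam (y + e ν) - Lam y) := by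
    rw [hL]
    funext ν y
    simp
  have hinv : ∀ᶠ U in 𝓝 (0 : Λ → T → 𝔄), fderiv ℝ ℰ₁ U (L (1 + U)) = 0 := by
    filter_upwards [hc.eventually (hdiff.and h47)] with U hU
    rw [hD, hL]
    exact fderiv_apply_gaugeGenerator_eq_zero e Lam hU.1 hU.2
  have h := ward_first_order (𝕜 := ℝ) h1C hX hinv U
  simp only [add_zero] at h
  rw [hXD, hDD, hD, add_zero, hL1, map_neg, neg_add_eq_zero] at h
  rw [h, hL]

/-- **(4.13) at `B = 0` IN THE CHART, for ONE `𝔤`-valued gauge function `λ`** (p. 284 (4.13) «⟨(δ²/δB²)𝐄(1), −∂λ, B₁⟩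
+ ⟨(δ/δB)𝐄(1), iad_{λ₋}B₁ − ½iad_{B₁}∂λ⟩ = 0»): for `f(B) = 𝐄(exp iρB)` on `𝔤`-valued fields,
`D²f(0)(B₁, ∂λ) = D𝐄(1)[½([ρλ₋, ρB₁] + [ρλ₊, ρB₁])]` — the Hessian of the chart functional on a pure gauge `∂λ` is
the gradient of `𝐄` on a field of COMMUTATORS (second-order chain rule `fderiv_fderiv_comp_chart_zero_apply` +
(4.10)|₀ `hessian_one_apply_grad_eq` + the pointwise identity `ward_plus_jordan_eq_half_commutators`; print's
`iad_{λ₋}B₁ − ½iad_{B₁}∂λ = ½[λ₋, B₁] + ½[λ₊, B₁]`, the factors `i` absorbed). [cite: Balaban1987RG1, (4.7) p.282,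
(4.9) p.283, (4.13) p.284] -/
theorem hessian_chart_apply_grad_eq {ℰ : (Λ → T → 𝔄) → F} (e : Λ → T) (ρ : V →L[ℝ] 𝔄) (hℰ : ContDiffAt ℝ 2 ℰ 1)
    (lam : T → V) (h47 : ∀ᶠ W in 𝓝 (1 : Λ → T → 𝔄), ∀ᶠ t in 𝓝 (0 : ℝ),
      ℰ (fun ν x => exp (t • ρ (lam x)) * W ν x * exp (-(t • ρ (lam (x + e ν))))) = ℰ W) (u : Λ → T → V) :
    fderiv ℝ (fderiv ℝ (fun B : Λ → T → V => ℰ (fun ν x => exp (ρ (B ν x))))) 0 u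
        (fun ν y => lam (y + e ν) - lam y) =
      fderiv ℝ ℰ 1 (fun ν x => (2 : ℝ)⁻¹ • ((ρ (lam x) * ρ (u ν x) - ρ (u ν x) * ρ (lam x)) +
        (ρ (lam (x + e ν)) * ρ (u ν x) - ρ (u ν x) * ρ (lam (x + e ν))))) := by
  rw [fderiv_fderiv_comp_chart_zero_apply ρ hℰ]
  simp only [map_sub]
  rw [hessian_one_apply_grad_eq e hℰ (fun x => ρ (lam x)) h47 (fun ν x => ρ (u ν x)), ← map_add]
  congr 1
  funext ν x
  simp only [Pi.add_apply]
  exact ward_plus_jordan_eq_half_commutators _ _ _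

end WardChart

/-! ## §3. «The group G is semisimple, hence» (4.14): the gradient of the chart functional vanishes at `B = 0` -/

section FourFourteen

variable {𝔄 : Type*} [NormedRing 𝔄] [NormedAlgebra ℝ 𝔄] [CompleteSpace 𝔄] {Λ T : Type*} [Fintype Λ] [Fintype T]
  [AddCommGroup T] {V : Type*} [NormedAddCommGroup V] [NormedSpace ℝ V] {F : Type*} [NormedAddCommGroup F]
  [NormedSpace ℝ F]

/-- **(4.14) «(δ/δB)𝐄(1) = 0» AT `B = 0` IN THE CHART, for `𝔤`-valued fields with `[𝔤, 𝔤] = 𝔤`** (p. 284 «For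
constant λ we get ⟨(δ/δB)𝐄(1), iad_λB₁⟩ = 0, and since the configuration B₁ is arbitrary, we get
[λ, (δ/δB)𝐄(1)] = 0 for all λ ∈ 𝔤^c. The group G is semisimple, hence this is possible only for the element 0 in the
algebra 𝔤^c. Thus we have the first, very important consequence of the gauge invariance (δ/δB)𝐄(1) = 0.»): if `𝐄`
is `C²` at `V = 1` and invariant near `V = 1` under the CONSTANT gauge transformations `exp(tρl)`, `l ∈ 𝔤`, for small
`t`, and the elements `c ∈ 𝔤` represented by commutators `ρc = [ρl, ρv]` SPAN `𝔤` (perfectness `[𝔤, 𝔤] = 𝔤` read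
through `ρ` — for `G` semisimple: `span_commutatorSet_eq_top_of_isSemisimple` below), then the derivative of
`f(B) = 𝐄(exp iρB)` at `B = 0` is ZERO.  Proof = print's: (4.13)-for-constant-`λ` gives `D𝐄(1)[ρl·W − W·ρl] = 0`
for every `W` (`…B12GaugeInv47.fderiv_one_apply_ad_eq_zero`); «since the configuration B₁ is arbitrary» — test on
`W` supported on one bond with value `ρv` — `D𝐄(1)` kills the one-bond fields with values `[ρl, ρv]`, hence (span,
`hspan`) every one-bond `𝔤`-valued field, hence every `𝔤`-valued field; and `Df(0)[u] = D𝐄(1)[ρu]`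
(`fderiv_comp_chart_zero_apply`).  MODEL NOTE: only the `𝔤`-DIRECTIONS of `D𝐄(1)` vanish — for the ambient
`𝔄 = M_N`-valued fields (4.14) is false in general (the trace direction), which is why `…B12GaugeInv47` had to keep
`h414 : fderiv ℝ ℰ 1 = 0` as a hypothesis; in the chart of `𝔤`-valued fields, print's actual setting, it is a theorem.
[cite: Balaban1987RG1, (4.13)-(4.14) p.284] -/
theorem fderiv_chart_zero_eq_zero {ℰ : (Λ → T → 𝔄) → F} (e : Λ → T) (ρ : V →L[ℝ] 𝔄) (hℰ : ContDiffAt ℝ 2 ℰ 1)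
    (h47 : ∀ l : V, ∀ᶠ W in 𝓝 (1 : Λ → T → 𝔄), ∀ᶠ t in 𝓝 (0 : ℝ),
      ℰ (fun ν x => exp (t • ρ l) * W ν x * exp (-(t • ρ l))) = ℰ W)
    (hspan : Submodule.span ℝ {c : V | ∃ l v : V, ρ c = ρ l * ρ v - ρ v * ρ l} = ⊤) :
    fderiv ℝ (fun B : Λ → T → V => ℰ (fun ν x => exp (ρ (B ν x)))) 0 = 0 := by
  classical
  have hdiff : DifferentiableAt ℝ ℰ 1 := hℰ.differentiableAt (by simp)
  have happ : ∀ u : Λ → T → V, fderiv ℝ (fun B : Λ → T → V => ℰ (fun ν x => exp (ρ (B ν x)))) 0 u =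
      fderiv ℝ ℰ 1 (fun ν x => ρ (u ν x)) := fderiv_comp_chart_zero_apply ρ hdiff
  -- «since the configuration B₁ is arbitrary»: one-bond fields with commutator values are killed
  have hsingle : ∀ (ν : Λ) (x : T) (c : V), c ∈ {c : V | ∃ l v : V, ρ c = ρ l * ρ v - ρ v * ρ l} →
      fderiv ℝ (fun B : Λ → T → V => ℰ (fun ν x => exp (ρ (B ν x)))) 0 (Pi.single ν (Pi.single x c)) = 0 := by
    rintro ν x c ⟨l, v, hc⟩
    rw [happ]
    have hW := fderiv_one_apply_ad_eq_zero e hℰ (ρ l) (h47 l) (Pi.single ν (Pi.single x (ρ v)))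
    have heq : (fun ν' x' => ρ ((Pi.single ν (Pi.single x c) : Λ → T → V) ν' x')) = fun ν' x' =>
        ρ l * (Pi.single ν (Pi.single x (ρ v)) : Λ → T → 𝔄) ν' x' -
          (Pi.single ν (Pi.single x (ρ v)) : Λ → T → 𝔄) ν' x' * ρ l := by
      funext ν' x'
      by_cases hν : ν' = ν
      · subst hν
        by_cases hx : x' = x
        · subst hx
          simp [hc]
        · simp [hx]
      · simp [hν]
    rw [heq]
    exact hW
  -- hence (span) every one-bond field, hence (linearity, bond by bond) every field
  have hlin : ((fderiv ℝ (fun B : Λ → T → V => ℰ (fun ν x => exp (ρ (B ν x)))) 0 :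
      (Λ → T → V) →L[ℝ] F) : (Λ → T → V) →ₗ[ℝ] F) = 0 := by
    refine LinearMap.pi_ext fun ν w => ?_
    have h2 : ((fderiv ℝ (fun B : Λ → T → V => ℰ (fun ν x => exp (ρ (B ν x)))) 0 :
        (Λ → T → V) →L[ℝ] F) : (Λ → T → V) →ₗ[ℝ] F).comp (LinearMap.single ℝ (fun _ : Λ => T → V) ν) = 0 := by
      refine LinearMap.pi_ext fun x c => ?_
      have h3 : (((fderiv ℝ (fun B : Λ → T → V => ℰ (fun ν x => exp (ρ (B ν x)))) 0 :
          (Λ → T → V) →L[ℝ] F) : (Λ → T → V) →ₗ[ℝ] F).comp (LinearMap.single ℝ (fun _ : Λ => T → V) ν)).comp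
            (LinearMap.single ℝ (fun _ : T => V) x) = 0 := by
        refine LinearMap.ext_on hspan (fun c hc => ?_)
        simp only [LinearMap.comp_apply, LinearMap.zero_apply, LinearMap.coe_single, ContinuousLinearMap.coe_coe]
        exact hsingle ν x c hc
      have h4 := LinearMap.congr_fun h3 c
      simpa using h4
    have h5 := LinearMap.congr_fun h2 w
    simpa using h5
  ext u
  have h6 := LinearMap.congr_fun hlin u
  simpa using h6

/-- **(4.14) for the `𝔤`-directions of `D𝐄(1)`**: under the hypotheses of `fderiv_chart_zero_eq_zero`,
`D𝐄(1)[(ρw_ν(x))_{ν,x}] = 0` for every `𝔤`-valued field `w`. [cite: Balaban1987RG1, (4.14) p.284] -/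
theorem fderiv_one_apply_rho_eq_zero {ℰ : (Λ → T → 𝔄) → F} (e : Λ → T) (ρ : V →L[ℝ] 𝔄) (hℰ : ContDiffAt ℝ 2 ℰ 1)
    (h47 : ∀ l : V, ∀ᶠ W in 𝓝 (1 : Λ → T → 𝔄), ∀ᶠ t in 𝓝 (0 : ℝ),
      ℰ (fun ν x => exp (t • ρ l) * W ν x * exp (-(t • ρ l))) = ℰ W)
    (hspan : Submodule.span ℝ {c : V | ∃ l v : V, ρ c = ρ l * ρ v - ρ v * ρ l} = ⊤) (w : Λ → T → V) :
    fderiv ℝ ℰ 1 (fun ν x => ρ (w ν x)) = 0 := by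
  rw [← fderiv_comp_chart_zero_apply ρ (hℰ.differentiableAt (by simp)) w, fderiv_chart_zero_eq_zero e ρ hℰ h47 hspan]
  rfl

end FourFourteen

/-! ## §4. (4.13) + (4.14) ⇒ (4.15)₁ «⟨(δ²/δB²)𝐄(1), B₁, ∂λ⟩ = 0» at `B = 0` in the chart -/

section FourFifteen

variable {𝔄 : Type*} [NormedRing 𝔄] [NormedAlgebra ℝ 𝔄] [CompleteSpace 𝔄] {Λ T : Type*} [Fintype Λ] [Fintype T]
  [AddCommGroup T] {V : Type*} [NormedAddCommGroup V] [NormedSpace ℝ V] {F : Type*} [NormedAddCommGroup F]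
  [NormedSpace ℝ F]

/-- **(4.7) + «G is semisimple» ⇒ (4.15)₁ AT `B = 0` IN THE CHART `V = exp iB` OF `𝔤`-VALUED FIELDS — BOTH lineage
hypotheses `h414` and `h415` DISCHARGED** (p. 284 «This equality simplifies the identities … We obtain the following
set of Ward-Takahashi identities ⟨(δ²/δB²)𝐄(1), B₁, ∂λ⟩ = 0, … for an arbitrary gauge function λ, and arbitrary
gauge fields B₁»): for `𝐄` `C²` at `V = 1` and invariant near `V = 1` under the gauge flows
`V ↦ (v_t(b₋)V(b)v_t(b₊)⁻¹)_b`, `v_t = exp(tρλ)`, of every `𝔤`-valued gauge function `λ` for small `t` ((4.7)), with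
`𝔤` (read through the representation `ρ`) CLOSED under commutators (`hcl`) and SPANNED by them (`hspan`) — both
automatic for `G` semisimple, `…_of_isSemisimple` below —: `D²[B ↦ 𝐄(exp iρB)](0)(B₁, ∂λ) = 0` for all `𝔤`-valued
`B₁`, `λ`.  Proof = print's: by (4.13)-in-the-chart (`hessian_chart_apply_grad_eq`) the left side is `D𝐄(1)` of a
`𝔤`-valued field of commutators, which (4.14) (`fderiv_one_apply_rho_eq_zero`) kills.  This is the hypothesis `h415`
of `…B12Ward59.ward59_of_limit_of_gaugeInvariance` / `eq59_of_limit_of_gaugeInvariance` /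
`moment2_eq_of_limit_of_gaugeInvariance` and of `…B12Rep538Limit.*_of_limit_of_gaugeInvariance` for the chart
functional of `𝔤`-valued fields. [cite: Balaban1987RG1, (4.7) p.282, (4.9) p.283, (4.13)-(4.15) p.284] -/
theorem hessian_chart_apply_grad_eq_zero {ℰ : (Λ → T → 𝔄) → F} (e : Λ → T) (ρ : V →L[ℝ] 𝔄)
    (hℰ : ContDiffAt ℝ 2 ℰ 1)
    (h47 : ∀ lam : T → V, ∀ᶠ W in 𝓝 (1 : Λ → T → 𝔄), ∀ᶠ t in 𝓝 (0 : ℝ),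
      ℰ (fun ν x => exp (t • ρ (lam x)) * W ν x * exp (-(t • ρ (lam (x + e ν))))) = ℰ W)
    (hcl : ∀ a b : V, ∃ c : V, ρ c = ρ a * ρ b - ρ b * ρ a)
    (hspan : Submodule.span ℝ {c : V | ∃ l v : V, ρ c = ρ l * ρ v - ρ v * ρ l} = ⊤)
    (u : Λ → T → V) (lam : T → V) :
    fderiv ℝ (fderiv ℝ (fun B : Λ → T → V => ℰ (fun ν x => exp (ρ (B ν x))))) 0 u
      (fun ν y => lam (y + e ν) - lam y) = 0 := by
  choose κ hκ using hcl
  rw [hessian_chart_apply_grad_eq e ρ hℰ lam (h47 lam) u]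
  have h414 := fderiv_one_apply_rho_eq_zero e ρ hℰ (fun l => h47 (fun _ => l)) hspan
    (fun ν x => (2 : ℝ)⁻¹ • (κ (lam x) (u ν x) + κ (lam (x + e ν)) (u ν x)))
  simpa only [map_smul, map_add, hκ] using h414

end FourFifteen

/-! ## §5. «The group G is semisimple»: closure and perfectness of `𝔤` read through a representation `ρ` -/

section Semisimple

variable {V : Type*} [AddCommGroup V] [Module ℝ V] {𝔄 : Type*} [Ring 𝔄] {𝔤 : Type*} [LieRing 𝔤] [LieAlgebra ℝ 𝔤]

/-- Closure: if `ρ ∘ eV⁻¹ : 𝔤 → 𝔄` intertwines the Lie bracket with the commutator (a representation of `𝔤` in the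
associative algebra `𝔄` — print's `𝔤^c ⊂ M_N(ℂ)`), every commutator `[ρa, ρb]` is `ρ` of an element (`hcl` of §4).
[folklore] -/
theorem exists_rho_eq_commutator (eV : V ≃ₗ[ℝ] 𝔤) (ρ : V → 𝔄)
    (hρ : ∀ a b : V, ρ (eV.symm ⁅eV a, eV b⁆) = ρ a * ρ b - ρ b * ρ a) (a b : V) :
    ∃ c : V, ρ c = ρ a * ρ b - ρ b * ρ a :=
  ⟨eV.symm ⁅eV a, eV b⁆, hρ a b⟩

/-- **Perfectness `[𝔤, 𝔤] = 𝔤` from «The group G is semisimple»** (p. 284): for `𝔤` a finite-dimensional SEMISIMPLE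
real Lie algebra (identified with the charge space `V` by any linear `eV`) represented in `𝔄` through `ρ`, the
elements `c` with `ρc` a commutator `[ρl, ρv]` span `V` — the hypothesis `hspan` of §§3–4.  By name from the
lineage's `…B12Ward414.span_range_adConst_eq_top_of_isSemisimple` (the ranges of the `ad_l` span the configuration
space; Cartan's criterion in Mathlib) on ONE bond, transported along `eV` (`…B12Ward414.span_range_eq_top_of_conj`).
[cite: Balaban1987RG1, (4.13)-(4.14) p.284] -/
theorem span_commutatorSet_eq_top_of_isSemisimple [FiniteDimensional ℝ 𝔤] [LieAlgebra.IsSemisimple ℝ 𝔤]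
    (eV : V ≃ₗ[ℝ] 𝔤) (ρ : V → 𝔄) (hρ : ∀ a b : V, ρ (eV.symm ⁅eV a, eV b⁆) = ρ a * ρ b - ρ b * ρ a) :
    Submodule.span ℝ {c : V | ∃ l v : V, ρ c = ρ l * ρ v - ρ v * ρ l} = ⊤ := by
  -- the generators `ad_{eV a}` pulled back to `V`
  let L : V → V →ₗ[ℝ] V := fun a =>
    { toFun := fun b => eV.symm ⁅eV a, eV b⁆
      map_add' := fun b b' => by simp
      map_smul' := fun r b => by simp }
  have hL : ∀ a b, L a b = eV.symm ⁅eV a, eV b⁆ := fun a b => rfl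
  -- `V ≃ (Unit → 𝔤)`, one bond
  let e : V ≃ₗ[ℝ] (Unit → 𝔤) := eV.trans (LinearEquiv.funUnique Unit ℝ 𝔤).symm
  have he : ∀ (b : V) (i : Unit), e b i = eV b := fun b i => by
    simp [e, LinearEquiv.funUnique]
  have hconj : ∀ a b, e (L a b) = adConst (K := ℝ) (eV a) (e b) := by
    intro a b
    funext i
    rw [adConst_apply, he, he, hL, LinearEquiv.apply_symm_apply]
  have htop' : Submodule.span ℝ (⋃ a : V, Set.range (adConst (K := ℝ) (ι := Unit) (eV a))) = ⊤ := by
    rw [eV.surjective.iUnion_comp (fun l : 𝔤 => Set.range (adConst (K := ℝ) (ι := Unit) l))]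
    exact span_range_adConst_eq_top_of_isSemisimple
  have htop : Submodule.span ℝ (⋃ a : V, Set.range (L a)) = ⊤ :=
    span_range_eq_top_of_conj e L (fun a => adConst (K := ℝ) (eV a)) hconj htop'
  apply top_le_iff.1
  rw [← htop]
  apply Submodule.span_mono
  intro c hc
  rcases Set.mem_iUnion.1 hc with ⟨a, b, rfl⟩
  exact ⟨a, b, by rw [hL, hρ]⟩

end Semisimple

/-! ## §6. By-name composition with the lineage: (4.7) + «G semisimple» + (5.1) + (5.2) ⇒ (5.9) for the limit tensor,
with `h414` AND `h415` discharged -/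

section Functional

variable {𝔄 : Type*} [NormedRing 𝔄] [NormedAlgebra ℝ 𝔄] [CompleteSpace 𝔄] {V : Type*} [NormedAddCommGroup V]
  [NormedSpace ℝ V] {d : ℕ} {P : Fin d → Fin d → Pt d → Pt d → ℝ} {ι : Type*} {l : Filter ι} [l.NeBot]
  {Tn : ι → Type*} [∀ n, AddCommGroup (Tn n)] [∀ n, Fintype (Tn n)] [∀ n, DecidableEq (Tn n)]

/-- **(5.9) for the limit tensor, the Ward hypothesis `h415` of `…B12Ward59.eq59_of_limit_of_gaugeInvariance` AND
the hypothesis `h414` of `…B12GaugeInv47.eq59_of_limit_of_gaugeInvariance47` BOTH REPLACED by the gauge invariance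
(4.7) of the finite-volume functionals and the structure of `𝔤`**: per volume `n` a `C²` function `𝐄 n` of the
ambient gauge field `W : Fin d → Tn n → 𝔄` (print's `𝐄^{(j)}(U_j(V))`, `V ∈ G^c ⊂ M_N`), invariant under
translations ((5.2), `hℰtransl`) and under the gauge flows of the `𝔤`-valued gauge functions near `V = 1` ((4.7),
`h47`, bonds `(y, y + π_n e_ν)`); `𝔤 = V` represented by `ρ`, closed under and spanned by commutators (`hcl`,
`hspan`); `Πv n` the Hessian kernel at `B = 0` of `B ↦ 𝐄 n(exp iρB)` on `𝔤`-valued fields (print's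
«(δ²/δB²)𝐄(U(exp iB))|_{B=0}», (5.1)) in the charge direction `v ∈ 𝔤`, and the pointwise limit (5.1) `Π` ⇒ (5.9)₁
`WardFirst K`, (5.9)₂, and their complex readings, for `K = Π(·, 0)`.
[cite: Balaban1987RG1, (4.7) p.282, (4.13)-(4.15) p.284, (5.1)-(5.2) p.292, (5.8)-(5.9) p.293] -/
theorem eq59_of_limit_of_gaugeInvariance_lie (π : ∀ n, Pt d →+ Tn n) {ℰ : ∀ n, (Fin d → Tn n → 𝔄) → ℝ}
    (hℰ : ∀ n, ContDiff ℝ 2 (ℰ n)) (ρ : V →L[ℝ] 𝔄) (v : V) {Pv : ∀ n, Fin d → Fin d → Tn n → Tn n → ℝ}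
    (hH : ∀ n μ ν x y, Pv n μ ν x y =
      fderiv ℝ (fderiv ℝ (fun B : Fin d → Tn n → V => ℰ n (fun κ z => exp (ρ (B κ z))))) 0
        (Pi.single μ (Pi.single x v)) (Pi.single ν (Pi.single y v)))
    (hlim : ∀ μ ν x y, Tendsto (fun n => Pv n μ ν (π n x) (π n y)) l (𝓝 (P μ ν x y)))
    (hℰtransl : ∀ n (a : Tn n) (W : Fin d → Tn n → 𝔄), ℰ n (fun μ y => W μ (y - a)) = ℰ n W)
    (h47 : ∀ n (lam : Tn n → V), ∀ᶠ W in 𝓝 (1 : Fin d → Tn n → 𝔄), ∀ᶠ t in 𝓝 (0 : ℝ),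
      ℰ n (fun ν y => exp (t • ρ (lam y)) * W ν y * exp (-(t • ρ (lam (y + π n (unitVec ν)))))) = ℰ n W)
    (hcl : ∀ a b : V, ∃ c : V, ρ c = ρ a * ρ b - ρ b * ρ a)
    (hspan : Submodule.span ℝ {c : V | ∃ a b : V, ρ c = ρ a * ρ b - ρ b * ρ a} = ⊤) :
    WardFirst (fun μ ν z => P μ ν z 0) ∧ (∀ μ z, ∑ ν, (P μ ν (z + unitVec ν) 0 - P μ ν z 0) = 0) ∧
      WardB (ofRealK fun μ ν z => P μ ν z 0) ∧ WardB₂ (ofRealK fun μ ν z => P μ ν z 0) :=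
  eq59_of_limit_of_gaugeInvariance π (f := fun n B => ℰ n (fun κ z => exp (ρ (B κ z))))
    (fun n => contDiff_comp_chart ρ (hℰ n)) v hH hlim
    (fun n a B => hℰtransl n a (fun κ z => exp (ρ (B κ z))))
    (fun n u lam => hessian_chart_apply_grad_eq_zero (fun ν => π n (unitVec ν)) ρ ((hℰ n).contDiffAt) (h47 n)
      hcl hspan u lam)

/-- **(5.9) for the limit tensor from (4.7), (5.1), (5.2) and «The group G is semisimple» ALONE**: as
`eq59_of_limit_of_gaugeInvariance_lie`, the charge space `V` being a finite-dimensional SEMISIMPLE real Lie algebra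
`𝔤` (any linear identification `eV`) represented in `𝔄` by `ρ` (`hρ`: `ρ` intertwines the bracket with the
commutator — print's `𝔤^c ⊂ M_N(ℂ)`, `G` semisimple; e.g. `𝔤^c = 𝔰𝔩(N, ℂ)` as a real Lie algebra for `G = SU(N)`).
[cite: Balaban1987RG1, (4.7) p.282, (4.13)-(4.15) p.284, (5.1)-(5.2) p.292, (5.8)-(5.9) p.293] -/
theorem eq59_of_limit_of_gaugeInvariance_of_isSemisimple {𝔤 : Type*} [LieRing 𝔤] [LieAlgebra ℝ 𝔤]
    [FiniteDimensional ℝ 𝔤] [LieAlgebra.IsSemisimple ℝ 𝔤] (eV : V ≃ₗ[ℝ] 𝔤)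
    (π : ∀ n, Pt d →+ Tn n) {ℰ : ∀ n, (Fin d → Tn n → 𝔄) → ℝ}
    (hℰ : ∀ n, ContDiff ℝ 2 (ℰ n)) (ρ : V →L[ℝ] 𝔄)
    (hρ : ∀ a b : V, ρ (eV.symm ⁅eV a, eV b⁆) = ρ a * ρ b - ρ b * ρ a) (v : V)
    {Pv : ∀ n, Fin d → Fin d → Tn n → Tn n → ℝ}
    (hH : ∀ n μ ν x y, Pv n μ ν x y =
      fderiv ℝ (fderiv ℝ (fun B : Fin d → Tn n → V => ℰ n (fun κ z => exp (ρ (B κ z))))) 0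
        (Pi.single μ (Pi.single x v)) (Pi.single ν (Pi.single y v)))
    (hlim : ∀ μ ν x y, Tendsto (fun n => Pv n μ ν (π n x) (π n y)) l (𝓝 (P μ ν x y)))
    (hℰtransl : ∀ n (a : Tn n) (W : Fin d → Tn n → 𝔄), ℰ n (fun μ y => W μ (y - a)) = ℰ n W)
    (h47 : ∀ n (lam : Tn n → V), ∀ᶠ W in 𝓝 (1 : Fin d → Tn n → 𝔄), ∀ᶠ t in 𝓝 (0 : ℝ),
      ℰ n (fun ν y => exp (t • ρ (lam y)) * W ν y * exp (-(t • ρ (lam (y + π n (unitVec ν)))))) = ℰ n W) :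
    WardFirst (fun μ ν z => P μ ν z 0) ∧ (∀ μ z, ∑ ν, (P μ ν (z + unitVec ν) 0 - P μ ν z 0) = 0) ∧
      WardB (ofRealK fun μ ν z => P μ ν z 0) ∧ WardB₂ (ofRealK fun μ ν z => P μ ν z 0) :=
  eq59_of_limit_of_gaugeInvariance_lie π hℰ ρ v hH hlim hℰtransl h47 (exists_rho_eq_commutator eV ρ hρ)
    (span_commutatorSet_eq_top_of_isSemisimple eV ρ hρ)

variable {C₁ δ₁ : ℝ} {μ₀ ν₀ : Fin d}

/-- **END TO END FROM (5.1)–(5.3), (4.7), «G semisimple» AND (5.10): (4.43), (4.45) and `Σ_y Π = 0` for the limit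
tensor** — `…B12Ward59.moment2_eq_of_limit_of_gaugeInvariance` for the chart functionals `B ↦ 𝐄 n(exp iρB)` of
`𝔤`-valued fields with its Ward hypothesis `h415` DISCHARGED by `hessian_chart_apply_grad_eq_zero`: per volume a
`C²` function `𝐄 n` of the ambient bond field, invariant under translations and direction permutations ((5.2),
`hℰtransl`, `hℰperm`), with the chart functional invariant under the reflections (5.3) (`hℰrefl`, the `𝔤`-valued
field reflected with the sign `rsgn`), invariant near `1` under the gauge flows (4.7) of the `𝔤`-valued gauge
functions (`h47`), `𝔤 ≅ V` semisimple and represented by `ρ` (`eV`, `hρ`); `Πv n` the Hessian kernels at `B = 0`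
((5.1)) in the charge direction `v`, intertwining projections, the pointwise limit (5.1), and for `K = Π(·, 0)` ONLY
the decay (5.10) ⇒ `Σ_y Π_{μν}(x, y)(y_κ − x_κ)(y_τ − x_τ) = β(δ_{μκ}δ_{ντ} + δ_{μτ}δ_{νκ} − 2δ_{μν}δ_{κτ})`,
`Σ_y Π_{μν}(x, y)(y_κ − x_κ) = 0`, `Σ_y Π_{μν}(x, y) = 0`. [cite: Balaban1987RG1, (4.7) p.282, (4.13)-(4.15) p.284,
(5.1)-(5.6) p.292, (5.7)-(5.10) p.293, (4.43) p.291, (4.45) p.292] -/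
theorem moment2_eq_of_limit_of_gaugeInvariance_of_isSemisimple {𝔤 : Type*} [LieRing 𝔤] [LieAlgebra ℝ 𝔤]
    [FiniteDimensional ℝ 𝔤] [LieAlgebra.IsSemisimple ℝ 𝔤] (eV : V ≃ₗ[ℝ] 𝔤)
    (π : ∀ n, Pt d →+ Tn n) {ℰ : ∀ n, (Fin d → Tn n → 𝔄) → ℝ}
    (hℰ : ∀ n, ContDiff ℝ 2 (ℰ n)) (ρ : V →L[ℝ] 𝔄)
    (hρ : ∀ a b : V, ρ (eV.symm ⁅eV a, eV b⁆) = ρ a * ρ b - ρ b * ρ a) (v : V)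
    {Pv : ∀ n, Fin d → Fin d → Tn n → Tn n → ℝ}
    (hH : ∀ n μ ν x y, Pv n μ ν x y =
      fderiv ℝ (fderiv ℝ (fun B : Fin d → Tn n → V => ℰ n (fun κ z => exp (ρ (B κ z))))) 0
        (Pi.single μ (Pi.single x v)) (Pi.single ν (Pi.single y v)))
    (hlim : ∀ μ ν x y, Tendsto (fun n => Pv n μ ν (π n x) (π n y)) l (𝓝 (P μ ν x y)))
    (hℰtransl : ∀ n (a : Tn n) (W : Fin d → Tn n → 𝔄), ℰ n (fun μ y => W μ (y - a)) = ℰ n W)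
    (rn : ∀ n, Equiv.Perm (Fin d) → Tn n ≃ Tn n) (hπr : ∀ n σ x, π n (permPt σ x) = rn n σ (π n x))
    (hℰperm : ∀ n (σ : Equiv.Perm (Fin d)) (W : Fin d → Tn n → 𝔄),
      ℰ n (fun ν y => W (σ.symm ν) ((rn n σ).symm y)) = ℰ n W)
    (tn : ∀ n, Fin d → Fin d → Tn n ≃ Tn n) (hπt : ∀ n r ν x, π n (twist r ν x) = tn n r ν (π n x))
    (hℰrefl : ∀ n r (B : Fin d → Tn n → V),
      ℰ n (fun κ z => exp (ρ (rsgn r κ • B κ (tn n r κ z)))) = ℰ n (fun κ z => exp (ρ (B κ z))))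
    (h47 : ∀ n (lam : Tn n → V), ∀ᶠ W in 𝓝 (1 : Fin d → Tn n → 𝔄), ∀ᶠ t in 𝓝 (0 : ℝ),
      ℰ n (fun ν y => exp (t • ρ (lam y)) * W ν y * exp (-(t • ρ (lam (y + π n (unitVec ν)))))) = ℰ n W)
    (hδ : 0 < δ₁) (h510 : ∀ μ ν, Decay510 (fun z => P μ ν z 0) C₁ δ₁) (h0 : μ₀ ≠ ν₀) (x : Pt d)
    (μ ν κ τ : Fin d) :
    ∑' y, P μ ν x y * (((y κ - x κ : ℤ) : ℝ) * ((y τ - x τ : ℤ) : ℝ)) =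
        B12Beta.secondMoment (fun μ ν z => P μ ν z 0) μ₀ ν₀ *
          (kdA μ κ * kdA ν τ + kdA μ τ * kdA ν κ - 2 * kdA μ ν * kdA κ τ) ∧
      ∑' y, P μ ν x y * ((y κ - x κ : ℤ) : ℝ) = 0 ∧ ∑' y, P μ ν x y = 0 :=
  moment2_eq_of_limit_of_gaugeInvariance π (f := fun n B => ℰ n (fun κ z => exp (ρ (B κ z))))
    (fun n => contDiff_comp_chart ρ (hℰ n)) v hH hlim (fun n a B => hℰtransl n a (fun κ z => exp (ρ (B κ z))))
    rn hπr (fun n σ B => hℰperm n σ (fun κ z => exp (ρ (B κ z)))) tn hπt hℰrefl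
    (fun n u lam => hessian_chart_apply_grad_eq_zero (fun ν => π n (unitVec ν)) ρ ((hℰ n).contDiffAt) (h47 n)
      (exists_rho_eq_commutator eV ρ hρ) (span_commutatorSet_eq_top_of_isSemisimple eV ρ hρ) u lam)
    hδ h510 h0 x μ ν κ τ

end Functional

end Literature.MathematicalPhysics.QuantumFieldTheory.Balaban1983to89.B12Semisimple414
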